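import Summits.QuantumFields.YangMills.Theorems.UnitScaleTiltProp7DivRecoveryAssemblyBudget
import Summits.QuantumFields.YangMills.Theorems.UnitScaleTiltProp7DivRecoveryForm
import Summits.QuantumFields.YangMills.Theorems.UnitScaleTiltProp7SectET3CombLettersT3
import HarnessLib

/-!
# Prop. 7 on T³ — lane II (B7-PATCHES⟹ROWS): `hRows` from the packaged member core row and the per-member PATCH SCHEMA

Route `UnitScaleTilt`, crux `MinimiserStabilityRegPr` (stmt-QuantumFields-19200), E′ growth side, lane II «divergence recovery at the curved regular member».
The last piece of quantifier plumbing: ✓`Prop7DivRecoveryCollectedOfRows.hColl_of_rows`' hypothesis `hRows` from (i) the conclusion `hCore` of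
✓`Prop7DivRecoveryMemberCorePackaged.member_core_row_packaged` (constants `a₁ a₂ a₃ a₄`, radius `eM`, BEFORE the member and before the patch exponent) and (ii) ONE
displayed schema `hPatch` — «at every member with `s < F.m + n` the cutoffs `Z ZE`, the local potentials `φ κs r` with the two local equations, the patch reals with
the seven per-patch bounds, the three overlap sums and the seven family-sum rows» — which is what the member GEOMETRY file delivers from the bricks ((B6) px11 ⊕ ζ̃∕geometry
px9 ⊕ (B8-member) px12 ⊕ (B9d) px4∕px9 ⊕ (B3a-loc) w1 ⊕ (QH1)♮ px19 ⊕ (B1″) px4).  The SHAPE of `hPatch` is hereby frozen by kernel.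

HONEST SCOPE.  Bookkeeping; `hCore`'s two schemas and `hPatch` are OPEN with named pens; nothing of (REC)∕hN06∕hcoS∕E′∕EX∕the crux is proved here; YM₃ on T³ is rung R3 —
NOT d = 4, NOT infinite volume, NOT a mass gap, NOT Clay.
[cite: Balaban1985BackgroundPropagators, (3.10) p.392, (3.19)-(3.26) pp.393-395]
-/

noncomputable section

open scoped InnerProductSpace ComplexConjugate BigOperators Matrix.Norms.L2Operator

namespace Summit.QuantumFields.YangMills.Theorems.Prop7DivRecoveryPatchesToRows

open Literature.MathematicalPhysics.QuantumFieldTheory.Balaban1983to89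
open Literature.MathematicalPhysics.QuantumFieldTheory.Balaban1983to89.T3ContinuumYM3Torus
open T3PrintedRegularMinimiser (RegPr)
open B11Eq103H1Complex (SiteL2K BondL2K)
open Summit.QuantumFields.YangMills.Theorems.Prop7SectET3Transport (periodsT3)
open Summit.QuantumFields.YangMills.Theorems.Prop7SectET3HilbertLetters (W₂ DL2 DstarL2 covLapSite)
open Summit.QuantumFields.YangMills.Theorems.Prop7SectET3WilsonHessian (DeltaEtaSlot)
open Summit.QuantumFields.YangMills.Theorems.Prop7SectET3CombLetters (Qkc)
open Summit.QuantumFields.YangMills.Theorems.Prop7QprimeCombL2 (RcombL2)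

variable (c₀ cB : ℕ → ℝ) [hc₀ : ∀ L : ℕ, Fact (0 < c₀ L)] [hcB : ∀ L : ℕ, Fact (0 < cB L)]

/-- ★★★ **(B7-PATCHES⟹ROWS).**  `hCore` = the conclusion of ✓`member_core_row_packaged` for a member functional `H`; `hPatch` = the per-member patch schema (module
docstring).  Conclusion: `hRows` of ✓`hColl_of_rows` VERBATIM (`ν a₂ a₃ cL cMR cHM` before `s`; `a₁ a₄` and the patch coefficients after; radius `min eM eP`, capped by
`eM ≤ 1`). [cite: Balaban1985BackgroundPropagators, (3.10) p.392, (3.19)-(3.26) pp.393-395] -/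
theorem hRows_of_core_and_patches
    (H : ∀ (F : T3Family) (n K : ℕ) (W : GaugeField (F.P K) 0 (Matrix.specialUnitaryGroup (Fin 2) ℂ)), BondL2K ℂ 3 (periodsT3 F K) (c₀ F.L) W₂ → ℝ)
    (hCore :
    ∀ (L : ℕ), 1 < L → ∃ a₁ a₂ a₃ a₄ eM : ℝ, 0 ≤ a₁ ∧ 0 ≤ a₂ ∧ 0 ≤ a₃ ∧ 0 ≤ a₄ ∧ 0 < eM ∧ eM ≤ 1 ∧
      ∀ (F : T3Family), F.L = L → ∀ (n K : ℕ) (hnK : n < K) (e : ℝ) (W : GaugeField (F.P K) 0 (Matrix.specialUnitaryGroup (Fin 2) ℂ)),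
        0 < e → e ≤ eM → RegPr F n K e W →
        ∀ {ι : Type} [Fintype ι]
          (Z : ι → SiteL2K ℂ 3 (periodsT3 F K) (c₀ F.L) W₂ →ₗ[ℂ] SiteL2K ℂ 3 (periodsT3 F K) (c₀ F.L) W₂) (_hZ : ∀ s, ∑ i, Z i s = s)
          (ZE : ι → BondL2K ℂ 3 (periodsT3 F K) (c₀ F.L) W₂ →ₗ[ℂ] BondL2K ℂ 3 (periodsT3 F K) (c₀ F.L) W₂) (_hZE : ∀ f, ∑ i, ZE i f = f)
          (y : BondL2K ℂ 3 (periodsT3 F K) (c₀ F.L) W₂) (φ κs : ι → SiteL2K ℂ 3 (periodsT3 F K) (c₀ F.L) W₂)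
          (_hloc : ∀ i, Z i (DstarL2 F n K (c₀ F.L) W y) = Z i (covLapSite F n K (c₀ F.L) W (φ i)) + Z i (κs i))
          (r : ι → BondL2K ℂ 3 (periodsT3 F K) (c₀ F.L) W₂) (_hDφ : ∀ i, ZE i (DL2 F n K (c₀ F.L) W (φ i)) = ZE i y - ZE i (r i)),
        ‖DstarL2 F n K (c₀ F.L) W y - RcombL2 F n K (c₀ F.L) W (DstarL2 F n K (c₀ F.L) W y)‖ ^ 2
          ≤ a₁ * ((c₀ F.L / cB F.L) * ((F.L : ℝ) ^ (K - n)) ^ 3 * ‖Qkc F n K hnK.le (c₀ F.L) (cB F.L) W y‖ ^ 2)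
            + a₂ * (‖∑ i, ZE i (r i)‖ ^ 2 + ‖∑ i, (DL2 F n K (c₀ F.L) W (Z i (φ i)) - ZE i (DL2 F n K (c₀ F.L) W (φ i)))‖ ^ 2)
            + a₃ * (H F n K W (∑ i, ZE i (r i)) + H F n K W (∑ i, (DL2 F n K (c₀ F.L) W (Z i (φ i)) - ZE i (DL2 F n K (c₀ F.L) W (φ i)))))
            + a₄ * e ^ 2 * ‖∑ i, Z i (φ i)‖ ^ 2
            + 3 * ‖∑ i, (covLapSite F n K (c₀ F.L) W (Z i (φ i)) - Z i (covLapSite F n K (c₀ F.L) W (φ i)))‖ ^ 2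
            + 3 * ‖∑ i, Z i (κs i)‖ ^ 2)
    (hPatch : ∀ (L : ℕ), 1 < L → ∃ ν cL cMR cHM : ℝ, 0 ≤ ν ∧ 0 ≤ cL ∧ 0 ≤ cMR ∧ 0 ≤ cHM ∧
      ∀ s : ℕ, ∃ cΦ cρCu cρN cKCu cKN cMAs cMCu cMe cHCu cHN eP : ℝ,
        0 ≤ cΦ ∧ 0 ≤ cρCu ∧ 0 ≤ cρN ∧ 0 ≤ cKCu ∧ 0 ≤ cKN ∧ 0 ≤ cMAs ∧ 0 ≤ cMCu ∧ 0 ≤ cMe ∧ 0 ≤ cHCu ∧ 0 ≤ cHN ∧ 0 < eP ∧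
        ∀ (F : T3Family), F.L = L → ∀ (n K : ℕ) (hnK : n < K) (e : ℝ) (W : GaugeField (F.P K) 0 (Matrix.specialUnitaryGroup (Fin 2) ℂ)),
          s < F.m + n → 0 < e → e ≤ eP → RegPr F n K e W →
          ∀ y : BondL2K ℂ 3 (periodsT3 F K) (c₀ F.L) W₂,
            ∃ (Z : Site (F.P K) 0 → SiteL2K ℂ 3 (periodsT3 F K) (c₀ F.L) W₂ →ₗ[ℂ] SiteL2K ℂ 3 (periodsT3 F K) (c₀ F.L) W₂)
              (ZE : Site (F.P K) 0 → BondL2K ℂ 3 (periodsT3 F K) (c₀ F.L) W₂ →ₗ[ℂ] BondL2K ℂ 3 (periodsT3 F K) (c₀ F.L) W₂)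
              (φ κs : Site (F.P K) 0 → SiteL2K ℂ 3 (periodsT3 F K) (c₀ F.L) W₂) (r : Site (F.P K) 0 → BondL2K ℂ 3 (periodsT3 F K) (c₀ F.L) W₂)
              (Ni Cui Asi ρi Φi Ki Li Mi Hρi HMi : Site (F.P K) 0 → ℝ),
              (∀ v, ∑ i, Z i v = v) ∧ (∀ f, ∑ i, ZE i f = f) ∧
              (∀ i, Z i (DstarL2 F n K (c₀ F.L) W y) = Z i (covLapSite F n K (c₀ F.L) W (φ i)) + Z i (κs i)) ∧
              (∀ i, ZE i (DL2 F n K (c₀ F.L) W (φ i)) = ZE i y - ZE i (r i)) ∧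
              (∀ i, Φi i ≤ cΦ * ((F.L : ℝ) ^ s) ^ 2 * Ni i) ∧
              (∀ i, ρi i ≤ cρCu * Cui i + cρN * e * Ni i) ∧
              (∀ i, Ki i ≤ cKCu * Cui i + cKN * e * Ni i) ∧
              (∀ i, Li i ≤ cL * ((F.L : ℝ) ^ s)⁻¹ ^ 2 * Ni i) ∧
              (∀ i, Mi i ≤ cMAs * Asi i + cMCu * Cui i + (cMR * ((F.L : ℝ) ^ s)⁻¹ ^ 2 + cMe * e) * Ni i) ∧
              (∀ i, Hρi i ≤ cHCu * Cui i + cHN * e * Ni i) ∧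
              (∀ i, HMi i ≤ cHM * ((F.L : ℝ) ^ s)⁻¹ ^ 2 * Ni i) ∧
              (∑ i, Ni i ≤ ν * ‖y‖ ^ 2) ∧
              (∑ i, Cui i ≤ ν * (RCLike.re ⟪y, DeltaEtaSlot F n K (c₀ F.L) W y⟫_ℂ + 1029 * e * ‖y‖ ^ 2)) ∧
              (∑ i, Asi i ≤ ν * ((c₀ F.L / cB F.L) * ((F.L : ℝ) ^ (K - n)) ^ 3 * ‖Qkc F n K hnK.le (c₀ F.L) (cB F.L) W y‖ ^ 2)) ∧
              (‖∑ i, ZE i (r i)‖ ^ 2 ≤ ν * ∑ i, ρi i) ∧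
              (‖∑ i, (DL2 F n K (c₀ F.L) W (Z i (φ i)) - ZE i (DL2 F n K (c₀ F.L) W (φ i)))‖ ^ 2 ≤ ν * ∑ i, Mi i) ∧
              (H F n K W (∑ i, ZE i (r i)) ≤ ν * ∑ i, Hρi i) ∧
              (H F n K W (∑ i, (DL2 F n K (c₀ F.L) W (Z i (φ i)) - ZE i (DL2 F n K (c₀ F.L) W (φ i)))) ≤ ν * ∑ i, HMi i) ∧
              (‖∑ i, (covLapSite F n K (c₀ F.L) W (Z i (φ i)) - Z i (covLapSite F n K (c₀ F.L) W (φ i)))‖ ^ 2 ≤ ν * ∑ i, Li i) ∧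
              (‖∑ i, Z i (κs i)‖ ^ 2 ≤ ν * ∑ i, Ki i) ∧
              (‖∑ i, Z i (φ i)‖ ^ 2 ≤ ν * ∑ i, Φi i)) :
    ∀ (L : ℕ), 1 < L → ∃ ν a₂ a₃ cL cMR cHM : ℝ, 0 ≤ ν ∧ 0 ≤ a₂ ∧ 0 ≤ a₃ ∧ 0 ≤ cL ∧ 0 ≤ cMR ∧ 0 ≤ cHM ∧
      ∀ s : ℕ, ∃ a₁ a₄ cΦ cρCu cρN cKCu cKN cMAs cMCu cMe cHCu cHN eC : ℝ,
        0 ≤ a₁ ∧ 0 ≤ a₄ ∧ 0 ≤ cΦ ∧ 0 ≤ cρCu ∧ 0 ≤ cρN ∧ 0 ≤ cKCu ∧ 0 ≤ cKN ∧ 0 ≤ cMAs ∧ 0 ≤ cMCu ∧ 0 ≤ cMe ∧ 0 ≤ cHCu ∧ 0 ≤ cHN ∧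
        0 < eC ∧ eC ≤ 1 ∧
        ∀ (F : T3Family), F.L = L → ∀ (n K : ℕ) (hnK : n < K) (e : ℝ) (W : GaugeField (F.P K) 0 (Matrix.specialUnitaryGroup (Fin 2) ℂ)),
          s < F.m + n → 0 < e → e ≤ eC → RegPr F n K e W →
          ∀ y : BondL2K ℂ 3 (periodsT3 F K) (c₀ F.L) W₂,
            ∃ (Ni Cui Asi ρi Φi Ki Li Mi Hρi HMi : Site (F.P K) 0 → ℝ) (Sr SM SHr SHM SL SK SΦ : ℝ),
              (∀ i, Φi i ≤ cΦ * ((F.L : ℝ) ^ s) ^ 2 * Ni i) ∧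
              (∀ i, ρi i ≤ cρCu * Cui i + cρN * e * Ni i) ∧
              (∀ i, Ki i ≤ cKCu * Cui i + cKN * e * Ni i) ∧
              (∀ i, Li i ≤ cL * ((F.L : ℝ) ^ s)⁻¹ ^ 2 * Ni i) ∧
              (∀ i, Mi i ≤ cMAs * Asi i + cMCu * Cui i + (cMR * ((F.L : ℝ) ^ s)⁻¹ ^ 2 + cMe * e) * Ni i) ∧
              (∀ i, Hρi i ≤ cHCu * Cui i + cHN * e * Ni i) ∧
              (∀ i, HMi i ≤ cHM * ((F.L : ℝ) ^ s)⁻¹ ^ 2 * Ni i) ∧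
              (∑ i, Ni i ≤ ν * ‖y‖ ^ 2) ∧
              (∑ i, Cui i ≤ ν * (RCLike.re ⟪y, DeltaEtaSlot F n K (c₀ F.L) W y⟫_ℂ + 1029 * e * ‖y‖ ^ 2)) ∧
              (∑ i, Asi i ≤ ν * ((c₀ F.L / cB F.L) * ((F.L : ℝ) ^ (K - n)) ^ 3 * ‖Qkc F n K hnK.le (c₀ F.L) (cB F.L) W y‖ ^ 2)) ∧
              (Sr ≤ ν * ∑ i, ρi i) ∧ (SM ≤ ν * ∑ i, Mi i) ∧ (SHr ≤ ν * ∑ i, Hρi i) ∧ (SHM ≤ ν * ∑ i, HMi i) ∧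
              (SL ≤ ν * ∑ i, Li i) ∧ (SK ≤ ν * ∑ i, Ki i) ∧ (0 ≤ SΦ) ∧ (SΦ ≤ ν * ∑ i, Φi i) ∧
              ‖DstarL2 F n K (c₀ F.L) W y - RcombL2 F n K (c₀ F.L) W (DstarL2 F n K (c₀ F.L) W y)‖ ^ 2
                ≤ a₁ * ((c₀ F.L / cB F.L) * ((F.L : ℝ) ^ (K - n)) ^ 3 * ‖Qkc F n K hnK.le (c₀ F.L) (cB F.L) W y‖ ^ 2)
                  + a₂ * (Sr + SM) + a₃ * (SHr + SHM) + a₄ * e ^ 2 * SΦ + 3 * SL + 3 * SK := by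
  intro L hL
  obtain ⟨a₁, a₂, a₃, a₄, eM, ha₁, ha₂, ha₃, ha₄, heM, heM1, hcore⟩ := hCore L hL
  obtain ⟨ν, cL, cMR, cHM, hν, hcL, hcMR, hcHM, hp⟩ := hPatch L hL
  refine ⟨ν, a₂, a₃, cL, cMR, cHM, hν, ha₂, ha₃, hcL, hcMR, hcHM, fun s => ?_⟩
  obtain ⟨cΦ, cρCu, cρN, cKCu, cKN, cMAs, cMCu, cMe, cHCu, cHN, eP, hcΦ, hcρCu, hcρN, hcKCu, hcKN, hcMAs, hcMCu, hcMe, hcHCu, hcHN, heP, hmem⟩ := hp s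
  refine ⟨a₁, a₄, cΦ, cρCu, cρN, cKCu, cKN, cMAs, cMCu, cMe, cHCu, cHN, min eM eP,
    ha₁, ha₄, hcΦ, hcρCu, hcρN, hcKCu, hcKN, hcMAs, hcMCu, hcMe, hcHCu, hcHN, lt_min heM heP, (min_le_left _ _).trans heM1, ?_⟩
  intro F hF n K hnK e W hsm he hemin hreg y
  have heM' : e ≤ eM := hemin.trans (min_le_left _ _)
  have heP' : e ≤ eP := hemin.trans (min_le_right _ _)
  obtain ⟨Z, ZE, φ, κs, r, Ni, Cui, Asi, ρi, Φi, Ki, Li, Mi, Hρi, HMi, hZ, hZE, hloc, hDφ,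
    hΦ, hρ, hK, hLi, hM, hHρ, hHM, hsumN, hsumCu, hsumAs, hSr, hSM, hSHr, hSHM, hSL, hSK, hSΦ⟩ :=
    hmem F hF n K hnK e W hsm he heP' hreg y
  have hc := hcore F hF n K hnK e W he heM' hreg Z hZ ZE hZE y φ κs hloc r hDφ
  refine ⟨Ni, Cui, Asi, ρi, Φi, Ki, Li, Mi, Hρi, HMi,
    ‖∑ i, ZE i (r i)‖ ^ 2, ‖∑ i, (DL2 F n K (c₀ F.L) W (Z i (φ i)) - ZE i (DL2 F n K (c₀ F.L) W (φ i)))‖ ^ 2,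
    H F n K W (∑ i, ZE i (r i)), H F n K W (∑ i, (DL2 F n K (c₀ F.L) W (Z i (φ i)) - ZE i (DL2 F n K (c₀ F.L) W (φ i)))),
    ‖∑ i, (covLapSite F n K (c₀ F.L) W (Z i (φ i)) - Z i (covLapSite F n K (c₀ F.L) W (φ i)))‖ ^ 2, ‖∑ i, Z i (κs i)‖ ^ 2, ‖∑ i, Z i (φ i)‖ ^ 2,
    hΦ, hρ, hK, hLi, hM, hHρ, hHM, hsumN, hsumCu, hsumAs, hSr, hSM, hSHr, hSHM, hSL, hSK, sq_nonneg _, hSΦ, ?_⟩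
  exact hc

end Summit.QuantumFields.YangMills.Theorems.Prop7DivRecoveryPatchesToRows

end
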